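import Mathlib
import Summits.Langlands.Langlands.Theorems.IwahoriTransientInertia
import Literature.NumberTheory.GaloisRepresentations.WeilDeligneOfGaloisUnramifiedProofs
import Literature.NumberTheory.GaloisRepresentations.WeilDeligneRepLadicProofs

/-!
# DAG edge `IwahoriDictionary ⟸ host ∧ junctions` — part 1/3: linear algebra and the Weil–Deligne recipe (decomp-langlands, lens-3 gen 27)

§A `charpoly (A · exp(s N)) = charpoly A` under `A N = c • N A` with `c` of infinite multiplicative order, and the exact `c`-pair `μ, cμ` of
eigenvalues of `A` when `N ≠ 0`; §B the Grothendieck–Deligne recipe (`IsWeilDeligneOfLadic`) with unipotent inertia forces `r.ρ|_{I_F} = 1`.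
Pure algebra over Mathlib and the tree's Weil–Deligne vocabulary; used by part 2 (`IwahoriTransientDictionaryEdge`).  Sorry-free.
-/

set_option linter.dupNamespace false
set_option linter.unusedVariables false
set_option linter.unusedSectionVars false

namespace Summit.Langlands.Langlands.Theorems.IwahoriTransient

open scoped Polynomial Matrix Pointwise
open Polynomial

namespace DictEdge

/-! ## §A. Linear algebra: `charpoly (A · exp(s N)) = charpoly A` under `A N = c N A`, and the exact `c`-pair -/

section ExpAlgebra

variable {K : Type*} [Field K] [CharZero K] {n : ℕ}

/-- `A N = c • N A ⇒ A Nⁱ = cⁱ • Nⁱ A`. -/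
theorem mul_pow_eq_smul_pow_mul (A N : Matrix (Fin n) (Fin n) K) {c : K} (hAN : A * N = c • (N * A)) :
    ∀ i : ℕ, A * N ^ i = c ^ i • (N ^ i * A) := by
  intro i
  induction i with
  | zero => simp
  | succ i ih =>
    rw [pow_succ, pow_succ, ← mul_assoc, ih, smul_mul_assoc, mul_assoc, hAN, mul_smul_comm, smul_smul, ← mul_assoc]

/-- `A N = c • N A`, `N` nilpotent ⇒ `A · exp(s N) = exp((c s) N) · A`. -/
theorem mul_exp_smul (A N : Matrix (Fin n) (Fin n) K) (hN : IsNilpotent N) {c : K} (hAN : A * N = c • (N * A)) (s : K) :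
    A * IsNilpotent.exp (s • N) = IsNilpotent.exp ((c * s) • N) * A := by
  obtain ⟨k, hk⟩ := hN
  have h1 : (s • N) ^ k = 0 := by rw [_root_.smul_pow, hk, smul_zero]
  have h2 : ((c * s) • N) ^ k = 0 := by rw [_root_.smul_pow, hk, smul_zero]
  rw [IsNilpotent.exp_eq_sum h1, IsNilpotent.exp_eq_sum h2, Finset.mul_sum, Finset.sum_mul]
  refine Finset.sum_congr rfl fun i _ => ?_
  rw [mul_smul_comm, smul_mul_assoc]
  congr 1
  rw [_root_.smul_pow, _root_.smul_pow, mul_smul_comm, smul_mul_assoc, mul_pow_eq_smul_pow_mul A N hAN i, smul_smul, mul_pow,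
    mul_comm (c ^ i) (s ^ i)]

/-- A polynomial invariant under `s ↦ c s` for a non-root-of-unity `c ≠ 0` is constant. -/
theorem eval_eq_eval_zero_of_scale {c : K} (hc0 : c ≠ 0) (hc1 : ∀ k : ℕ, 0 < k → c ^ k ≠ 1) (g : K[X])
    (h : ∀ s : K, g.eval s = g.eval (c * s)) (s : K) : g.eval s = g.eval 0 := by
  have hk : ∀ k : ℕ, g.eval (c ^ k) = g.eval 1 := by
    intro k
    induction k with
    | zero => simp
    | succ k ih => rw [pow_succ', ← ih]; exact (h (c ^ k)).symm
  have aux : ∀ j k : ℕ, j < k → c ^ j ≠ c ^ k := by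
    intro j k hjk hjk'
    obtain ⟨d, rfl⟩ := Nat.exists_eq_add_of_lt hjk
    rw [add_assoc, pow_add] at hjk'
    exact hc1 (d + 1) (Nat.succ_pos d) ((mul_eq_left₀ (pow_ne_zero j hc0)).mp hjk'.symm)
  have hinj : Function.Injective (fun k : ℕ => c ^ k) := by
    intro j k hjk
    by_contra hne
    rcases Nat.lt_or_gt_of_ne hne with hlt | hlt
    · exact aux _ _ hlt hjk
    · exact aux _ _ hlt hjk.symm
  have hroots : {x | (g - Polynomial.C (g.eval 1)).IsRoot x}.Infinite := by
    refine Set.infinite_of_injective_forall_mem hinj fun k => ?_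
    simp [hk k]
  have hg : g = Polynomial.C (g.eval 1) := sub_eq_zero.mp (Polynomial.eq_zero_of_infinite_isRoot _ hroots)
  rw [hg]; simp

/-- **The characteristic polynomial of `A · exp(s N)` does not depend on `s`** when `A` is invertible, `N` is nilpotent and
`A N = c N A` with `c ≠ 0` not a root of unity (the Weil–Deligne relation `φ(Φ⁻¹) N = q N φ(Φ⁻¹)`): the coefficients are polynomials
in `s` invariant under `s ↦ c s` (conjugation by `A`), hence constant. -/
theorem charpoly_mul_exp_smul (A N : Matrix (Fin n) (Fin n) K) (hA : IsUnit A) (hN : IsNilpotent N)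
    {c : K} (hc0 : c ≠ 0) (hc1 : ∀ k : ℕ, 0 < k → c ^ k ≠ 1) (hAN : A * N = c • (N * A)) (s : K) :
    (A * IsNilpotent.exp (s • N)).charpoly = A.charpoly := by
  -- (1) the scaling symmetry `s ↦ c s`
  have hsym : ∀ s : K, (A * IsNilpotent.exp (s • N)).charpoly = (A * IsNilpotent.exp ((c * s) • N)).charpoly := by
    intro s
    obtain ⟨u, hu⟩ := hA
    rw [← hu, ← Matrix.charpoly_units_conj u ((u : Matrix (Fin n) (Fin n) K) * IsNilpotent.exp (s • N)),
      mul_exp_smul (u : Matrix (Fin n) (Fin n) K) N hN (by rw [hu]; exact hAN) s, ← mul_assoc,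
      Matrix.mul_nonsing_inv_cancel_right _ _ ((Matrix.isUnit_iff_isUnit_det _).mp u.isUnit)]
  -- (2) the coefficients are polynomial in `s`
  set Ap : Matrix (Fin n) (Fin n) K[X] := A.map Polynomial.C with hAp
  set Np : Matrix (Fin n) (Fin n) K[X] := N.map Polynomial.C with hNp
  have hNpn : IsNilpotent Np := by
    simpa [hNp] using hN.map (Polynomial.C : K →+* K[X]).mapMatrix
  have hXN : IsNilpotent ((X : K[X]) • Np) := hNpn.smul _
  set P : K[X][X] := (Ap * IsNilpotent.exp ((X : K[X]) • Np)).charpoly with hP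
  have hev : ∀ s : K, P.map (Polynomial.evalRingHom s) = (A * IsNilpotent.exp (s • N)).charpoly := by
    intro s
    have e1 : Ap.map (Polynomial.evalRingHom s) = A := by
      ext i j; simp [hAp]
    have e2 : (IsNilpotent.exp ((X : K[X]) • Np)).map (Polynomial.evalRingHom s) = IsNilpotent.exp (s • N) := by
      rw [← RingHom.mapMatrix_apply, IsNilpotent.map_exp hXN]
      congr 1
      ext i j
      simp [hNp]
      ring
    rw [hP, ← Matrix.charpoly_map, Matrix.map_mul, e1, e2]
  have hcoeff : ∀ (i : ℕ) (s : K), (P.coeff i).eval s = ((A * IsNilpotent.exp (s • N)).charpoly).coeff i := by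
    intro i s
    rw [← hev s, Polynomial.coeff_map]
    rfl
  -- (3) constancy of each coefficient
  have hconst : ∀ (i : ℕ) (s : K), (P.coeff i).eval s = (P.coeff i).eval 0 := by
    intro i
    refine eval_eq_eval_zero_of_scale hc0 hc1 _ fun s => ?_
    rw [hcoeff, hcoeff, hsym s]
  -- (4) conclusion at `s = 0`
  ext i
  rw [← hcoeff i s, hconst i s, hcoeff i 0, zero_smul, IsNilpotent.exp_zero, mul_one]

/-- Eigenvector criterion for roots of the characteristic polynomial. -/
theorem isRoot_charpoly_of_mulVec_eq (A : Matrix (Fin n) (Fin n) K) {μ : K} {y : Fin n → K} (hy : y ≠ 0)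
    (h : A *ᵥ y = μ • y) : A.charpoly.IsRoot μ := by
  rw [Polynomial.IsRoot.def, Matrix.eval_charpoly, ← Matrix.exists_mulVec_eq_zero_iff]
  refine ⟨y, hy, ?_⟩
  rw [Matrix.sub_mulVec, h]
  ext i
  simp [Matrix.scalar_apply]

/-- **The exact `c`-pair.** Over an algebraically closed field, if `A` is invertible, `N ≠ 0` and `A N = c N A` (`c ≠ 0`), then
`charpoly A` has roots `μ ≠ 0` and `c μ` (restrict `A` to the `A`-stable subspace `N V ≠ 0`, take an eigenvector `y = N x`,
`A y = ν y`; then `μ = c⁻¹ ν` is a root, for otherwise `μ - A` is invertible on `ker N` and `x ∈ ker N`). -/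
theorem exists_root_pair [IsAlgClosed K] (A N : Matrix (Fin n) (Fin n) K) (hA : IsUnit A) (hN0 : N ≠ 0)
    {c : K} (hc0 : c ≠ 0) (hAN : A * N = c • (N * A)) :
    ∃ μ : K, μ ≠ 0 ∧ A.charpoly.IsRoot μ ∧ A.charpoly.IsRoot (c * μ) := by
  have hdetA : A.det ≠ 0 := ((Matrix.isUnit_iff_isUnit_det A).mp hA).ne_zero
  have hNA : N * A = c⁻¹ • (A * N) := by rw [hAN, smul_smul, inv_mul_cancel₀ hc0, one_smul]
  have hscal : ∀ (μ : K) (w : Fin n → K), Matrix.scalar (Fin n) μ *ᵥ w = μ • w := by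
    intro μ w; ext i; simp [Matrix.scalar_apply, Matrix.mulVec_diagonal]
  -- the `A`-stable subspace `W = N V`
  let f : Module.End K (Fin n → K) := Matrix.toLin' A
  let g : Module.End K (Fin n → K) := Matrix.toLin' N
  set W : Submodule K (Fin n → K) := LinearMap.range g with hW
  have hfW : ∀ w ∈ W, f w ∈ W := by
    rintro _ ⟨x, rfl⟩
    refine ⟨c • f x, ?_⟩
    simp only [f, g, Matrix.toLin'_apply, Matrix.mulVec_mulVec, hNA, Matrix.smul_mulVec, smul_smul,
      mul_inv_cancel₀ hc0, one_smul, map_smul]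
  have hWne : W ≠ ⊥ := by
    intro hbot
    apply hN0
    have hg0 : g = 0 := LinearMap.range_eq_bot.mp (by rw [← hW]; exact hbot)
    exact (LinearEquiv.map_eq_zero_iff Matrix.toLin').mp hg0
  haveI : Nontrivial W := Submodule.nontrivial_iff_ne_bot.mpr hWne
  obtain ⟨ν, hν⟩ := Module.End.exists_eigenvalue (f.restrict hfW)
  obtain ⟨y, hy⟩ := hν.exists_hasEigenvector
  have hy0 : (y : Fin n → K) ≠ 0 := fun h => hy.2 ((Submodule.coe_eq_zero).mp h)
  have hAy : A *ᵥ (y : Fin n → K) = ν • (y : Fin n → K) := by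
    have := congrArg Subtype.val hy.apply_eq_smul
    simpa [LinearMap.restrict_apply, f] using this
  obtain ⟨x, hx⟩ : ∃ x : Fin n → K, N *ᵥ x = y := by
    obtain ⟨x, hx⟩ := LinearMap.mem_range.mp y.2
    exact ⟨x, by simpa [g] using hx⟩
  have hν0 : ν ≠ 0 := by
    rintro rfl
    rw [zero_smul] at hAy
    exact hdetA (Matrix.exists_mulVec_eq_zero_iff.mp ⟨_, hy0, hAy⟩)
  refine ⟨c⁻¹ * ν, mul_ne_zero (inv_ne_zero hc0) hν0, ?_, by
    rw [mul_inv_cancel_left₀ hc0]; exact isRoot_charpoly_of_mulVec_eq A hy0 hAy⟩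
  -- `μ := c⁻¹ ν` is a root: otherwise `μ - A` is injective, preserves `ker N`, and forces `N x = 0`
  by_contra hμ
  set μ : K := c⁻¹ * ν with hμdef
  set B : Matrix (Fin n) (Fin n) K := Matrix.scalar (Fin n) μ - A with hB
  have hBdet : B.det ≠ 0 := by
    intro h; apply hμ; rw [Polynomial.IsRoot.def, Matrix.eval_charpoly]; exact h
  have hBinj : Function.Injective B.mulVec :=
    Matrix.mulVec_injective_iff_isUnit.mpr ((Matrix.isUnit_iff_isUnit_det B).mpr (isUnit_iff_ne_zero.mpr hBdet))
  have hNB : ∀ w : Fin n → K, N *ᵥ (B *ᵥ w) = μ • (N *ᵥ w) - c⁻¹ • (A *ᵥ (N *ᵥ w)) := by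
    intro w
    rw [hB, Matrix.sub_mulVec, Matrix.mulVec_sub, hscal, Matrix.mulVec_smul, Matrix.mulVec_mulVec, hNA,
      Matrix.smul_mulVec, ← Matrix.mulVec_mulVec]
  have hNz : N *ᵥ (B *ᵥ x) = 0 := by
    rw [hNB, hx, hAy, smul_smul, sub_self]
  let U : Submodule K (Fin n → K) := LinearMap.ker (Matrix.toLin' N)
  have hBU : ∀ w ∈ U, Matrix.toLin' B w ∈ U := by
    intro w hw
    simp only [U, LinearMap.mem_ker, Matrix.toLin'_apply] at hw ⊢
    rw [hNB, hw, Matrix.mulVec_zero, smul_zero, smul_zero, sub_zero]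
  have hinj' : Function.Injective ((Matrix.toLin' B).restrict hBU) := by
    intro a b hab
    apply Subtype.ext
    apply hBinj
    simpa [LinearMap.restrict_apply] using congrArg Subtype.val hab
  have hsurj := LinearMap.injective_iff_surjective.mp hinj'
  obtain ⟨w, hw⟩ := hsurj ⟨B *ᵥ x, by simpa [U, LinearMap.mem_ker, Matrix.toLin'_apply] using hNz⟩
  have hw' : B *ᵥ (w : Fin n → K) = B *ᵥ x := by
    simpa [LinearMap.restrict_apply] using congrArg Subtype.val hw
  have hxw : (w : Fin n → K) = x := hBinj hw'
  have hNx : N *ᵥ x = 0 := by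
    have := w.2
    simp only [U, LinearMap.mem_ker, Matrix.toLin'_apply, hxw] at this
    exact this
  exact hy0 (by rw [← hx, hNx])

end ExpAlgebra

/-! ## §B. The Grothendieck–Deligne recipe with unipotent inertia: `r.ρ|_{I_F} = 1` -/

section Recipe

open Literature.NumberTheory.GaloisRepresentations

variable {F : Type*} [Field F] [ValuativeRel F] [TopologicalSpace F] [IsNonarchimedeanLocalField F]
variable {E : Type*} [Field E] [CharZero E] {n : ℕ}

/-- `toMatrix'` is multiplicative on powers (through `LinearMap.toMatrixAlgEquiv'`). -/
theorem toMatrix'_pow_eq (f : Module.End E (Fin n → E)) (k : ℕ) :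
    LinearMap.toMatrix' (f ^ k) = (LinearMap.toMatrix' f) ^ k := by
  rw [show LinearMap.toMatrix' (f ^ k) = LinearMap.toMatrixAlgEquiv' (f ^ k) from rfl, map_pow]; rfl

/-- **Unipotent inertia ⇒ the Weil–Deligne parameter is trivial on inertia.**  If `r` is attached to `ρW : W_F → GL_n(E)` by the
Grothendieck–Deligne recipe (`IsWeilDeligneOfLadic`) and `ρW(u)` is unipotent for every `u` in the Weil inertia, then `r.ρ(u) = 1` on
inertia: `r.ρ(u) = ρW(u)·exp(−t(u)N)` is a product of two commuting unipotents, hence unipotent, and has finite order (it is `1` on the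
open subgroup `U` of the compact inertia), hence is `1` (`eq_one_of_isNilpotent_sub_one_of_pow_eq_one`). -/
theorem wd_inertia_eq_one (ρW : WeilGroup F →* GL (Fin n) E) (r : WeilDeligneRep F E (Fin n → E))
    (h : IsWeilDeligneOfLadic ρW r)
    (hunip : ∀ u ∈ WeilGroup.inertia F, IsNilpotent (((ρW u : GL (Fin n) E) : Matrix (Fin n) (Fin n) E) - 1)) :
    ∀ u ∈ WeilGroup.inertia F, r.ρ u = 1 := by
  obtain ⟨t, U, Φ, hUI, hUo, hΦ, ht, hU, hρ⟩ := h
  have hmul : IsFrobPow.mul (F := F) := IsFrobPow.mul_holds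
  have huniq : IsFrobPow.unique (F := F) := IsFrobPow.unique_holds
  set Nm : Matrix (Fin n) (Fin n) E := LinearMap.toMatrix' r.N with hNm
  have hNmn : IsNilpotent Nm := r.isNilpotent_N.map LinearMap.toMatrixAlgEquiv'
  -- (i) on `U`, `r.ρ = 1`
  have hU1 : ∀ u : WeilGroup.inertia F, (u : WeilGroup F) ∈ U → LinearMap.toMatrix' (r.ρ u) = 1 := by
    intro u hu
    have h0 := hρ 0 u
    rw [zpow_zero, one_mul] at h0
    rw [h0, hU u hu]
    exact IsNilpotent.exp_mul_exp_neg_self (hNmn.smul _)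
  -- (ii) `R(u) := [r.ρ u]` commutes with `N` and is unipotent for `u ∈ I`
  have hcommN : ∀ u ∈ WeilGroup.inertia F, Commute (LinearMap.toMatrix' (r.ρ u)) Nm := by
    intro u hu
    have hdeg : WeilGroup.deg u = 0 := (WeilGroup.deg_eq_zero_iff_mem_inertia hmul huniq).mpr hu
    have hc := r.conj_N u
    rw [hdeg, zpow_zero, one_smul] at hc
    have := congrArg LinearMap.toMatrix' hc
    rw [LinearMap.toMatrix'_comp, LinearMap.toMatrix'_comp] at this
    exact this
  have hunipR : ∀ u ∈ WeilGroup.inertia F, IsNilpotent (LinearMap.toMatrix' (r.ρ u) - 1) := by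
    intro u hu
    have h0 := hρ 0 ⟨u, hu⟩
    rw [zpow_zero, one_mul] at h0
    set s : E := (t ⟨u, hu⟩).toAdd with hs
    have hsN : IsNilpotent (s • Nm) := hNmn.smul s
    have hsN' : IsNilpotent (-(s • Nm)) := hsN.neg
    have e2 : IsNilpotent.exp (-(s • Nm)) * IsNilpotent.exp (s • Nm) = 1 := IsNilpotent.exp_neg_mul_exp_self hsN
    have hP : ((ρW u : GL (Fin n) E) : Matrix (Fin n) (Fin n) E) = LinearMap.toMatrix' (r.ρ u) * IsNilpotent.exp (s • Nm) := by
      rw [h0, mul_assoc, e2, mul_one]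
    have hE : Commute (IsNilpotent.exp (s • Nm)) Nm := (Literature.NumberTheory.GaloisRepresentations.Ladic.commute_exp_of_commute ((Commute.refl Nm).smul_right s) hsN).symm
    have hPN : Commute ((ρW u : GL (Fin n) E) : Matrix (Fin n) (Fin n) E) Nm := by
      rw [hP]; exact (hcommN u hu).mul_left hE
    have hPE : Commute ((ρW u : GL (Fin n) E) : Matrix (Fin n) (Fin n) E) (IsNilpotent.exp (-(s • Nm))) :=
      Literature.NumberTheory.GaloisRepresentations.Ladic.commute_exp_of_commute (hPN.smul_right s).neg_right hsN'
    rw [h0]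
    exact isNilpotent_mul_sub_one (hunip u hu) (IsNilpotent.isNilpotent_exp_sub_one hsN') hPE
  -- (iii) finite order modulo `U` (compactness of the Weil inertia) and conclusion
  haveI : IsTopologicalGroup (WeilGroup F) := WeilGroup.isTopologicalGroup_holds F
  haveI : CompactSpace (WeilGroup.inertia F) := isCompact_iff_compactSpace.mp (WeilGroup.isCompact_inertia_holds F)
  set U' : Subgroup (WeilGroup.inertia F) := U.comap (WeilGroup.inertia F).subtype with hU'
  have hU'o : IsOpen (U' : Set (WeilGroup.inertia F)) := hUo.preimage continuous_subtype_val
  haveI : Finite ((WeilGroup.inertia F) ⧸ U') := Subgroup.quotient_finite_of_isOpen U' hU'o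
  have hidx : U'.index ≠ 0 := Subgroup.index_ne_zero_of_finite
  intro u hu
  obtain ⟨k, hk0, -, hk⟩ := Subgroup.exists_pow_mem_of_index_ne_zero hidx ⟨u, hu⟩
  have huk : u ^ k ∈ U := by simpa [hU', Subgroup.mem_subgroupOf, Subgroup.mem_comap] using hk
  have hRk : (LinearMap.toMatrix' (r.ρ u)) ^ k = 1 := by
    rw [← toMatrix'_pow_eq, ← map_pow]
    exact hU1 ⟨u ^ k, Subgroup.pow_mem _ hu k⟩ huk
  have hR1 : LinearMap.toMatrix' (r.ρ u) = 1 := eq_one_of_isNilpotent_sub_one_of_pow_eq_one (hunipR u hu) hk0.ne' hRk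
  apply LinearMap.toMatrix'.injective
  rw [hR1, LinearMap.toMatrix'_one]

end Recipe

end DictEdge

end Summit.Langlands.Langlands.Theorems.IwahoriTransient
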